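import Mathlib
import Literature.Combinatorics.SimpleGraph.LovaszTheta
import Literature.Combinatorics.SimpleGraph.LovaszThetaDual
import HarnessLib

/-!
# Szegedy's `ϑ⁺`: the Lovász number with the edge constraints relaxed to inequalities

Szegedy (1994) introduced the variant `ϑ⁺` of the Lovász theta number obtained, in the
maximisation form `ϑ(G) = max {⟨J, X⟩ : Tr X = 1, X_{ij} = 0 (ij ∈ E), X ⪰ 0}`, by relaxing the
edge equalities to inequalities:
`ϑ⁺(G) = max {⟨J, X⟩ : X ∘ A ≤ 0, Tr X = 1, X ⪰ 0}` — "upon making small variations in the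
formulations, one obtains, respectively, the Schrijver theta and the Szegedy theta functions"
(de Carli Silva–Coutinho–Godsil–Roberson 2019, §4); dually, in Lovász's
minimisation form for the complement, `ϑ̄⁺(G) = min {λ : ∃ Z ⪰ 0, Z_{ii} = λ - 1,
Z_{ij} = -1 (i ∼ j), Z_{ij} ≥ -1 for all i, j}` (Cubitt–Mančinska–Roberson–Severini–Stahlke–Winter
2014, Definition 5). Together with Schrijver's `ϑ⁻ = ϑ'` (the tree's
`Literature.Combinatorics.Optimization.SchrijverTheta`) these satisfy the refined sandwich
`α(G) ≤ ϑ⁻(G) ≤ ϑ(G) ≤ ϑ⁺(G) ≤ χ(Ḡ)` (de Carli Silva et al. 2019, §4: "It is known since the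
first respective appearances of these thetas that, for all graphs …"; Cubitt et al. 2014, p. 9).

On top of the tree's `IsThetaFeasible` / `entrySum` / `lovaszTheta`
(`Literature.Combinatorics.SimpleGraph.LovaszTheta`) we give

* `IsThetaPlusFeasible G B` (`B ⪰ 0`, `Tr B = 1`, `B_{uv} ≤ 0` on the edges of `G`) and
  `szegedyTheta G = sup {𝟙ᵀB𝟙 : B ϑ⁺-feasible}` (a real supremum, bounded by `|V|`; for empty
  `V` the junk value `sSup ∅ = 0`);
* `lovaszTheta_le_szegedyTheta : ϑ(G) ≤ ϑ⁺(G)` (every Lovász-feasible matrix is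
  `ϑ⁺`-feasible), `szegedyTheta_le_card : ϑ⁺(G) ≤ |V|`, `szegedyTheta_anti` (monotone under
  edge deletion), `indepNum_le_szegedyTheta : α(G) ≤ ϑ⁺(G)`;
* **the top of Szegedy's sandwich** `szegedyTheta_compl_le_of_coloring : ϑ⁺(Ḡ) ≤ c` for every
  proper `c`-colouring of `G` — Lovász's averaging argument
  `𝟙ᵀB𝟙 = Σ_{a,b} 𝟙_aᵀB𝟙_b ≤ c Σ_a 𝟙_aᵀB𝟙_a` over the colour classes survives the relaxation
  because within a class the off-diagonal entries are now `≤ 0` instead of `= 0`, so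
  `Σ_a 𝟙_aᵀB𝟙_a ≤ Tr B = 1`; whence `sandwich_plus : α(G) ≤ ϑ(G) ≤ ϑ⁺(G) ≤ k` for
  `Ḡ` `k`-colourable;
* the sanity values `szegedyTheta_top : ϑ⁺(K_n) = 1` and `szegedyTheta_bot : ϑ⁺(K̄_n) = n`.

Not here: the minimisation / orthonormal-representation forms of `ϑ⁺` and strong duality, the
product relation `ϑ⁻(Ḡ) ϑ⁺(G) ≥ n`, vector-colouring characterisations (`ϑ⁺(Ḡ)` is the rigid
vector chromatic number), and separating examples `ϑ < ϑ⁺`.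

## References

* M. Szegedy, *A note on the θ number of Lovász and the generalized Delsarte bound*, Proc. 35th
  FOCS (1994) 36–39 [Szegedy1994] (the original definition of `ϑ⁺`; not held — cited through the
  two secondary sources below).
* M. K. de Carli Silva, G. Coutinho, C. Godsil, D. E. Roberson, *Algebras, graphs and thetas*,
  Electron. Notes Theor. Comput. Sci. 346 (2019) 275–283, §4 "Thetas" (the programmes for `ϑ`,
  `ϑ⁻`, `ϑ⁺` and the chain `α ≤ ϑ⁻ ≤ ϑ ≤ ϑ⁺ ≤ χ(Ḡ)`) [SilvaEtAl2019] (held: arXiv:1910.06260,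
  p. 6 of the arXiv version).
* T. Cubitt, L. Mančinska, D. E. Roberson, S. Severini, D. Stahlke, A. Winter, *Bounds on
  entanglement-assisted source-channel coding via the Lovász `ϑ` number and its variants*, IEEE
  Trans. Inform. Theory 60 (2014) 7330–7344, Definition 5 and p. 9 [CubittEtAl2013] (held:
  `lit read arxiv:1310.7120`, pp. 8–9).
-/

noncomputable section

namespace Literature.Combinatorics.SimpleGraph.SzegedyTheta

open Matrix Finset
open Literature.Combinatorics.SimpleGraph

variable {V : Type*} [Fintype V]

/-! ### Feasible matrices and `ϑ⁺` -/

/-- **Feasible matrices of Szegedy's programme for `ϑ⁺(G)`**: `B ⪰ 0`, `Tr B = 1` and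
`B_{uv} ≤ 0` on the edges of `G` (the Lovász constraint `B_{uv} = 0` relaxed to an inequality,
"`X ∘ A ≤ 0`"). [cite: SilvaEtAl2019, §4 (the programme defining ϑ⁺; arXiv p. 6)]
[cite: Szegedy1994] -/
structure IsThetaPlusFeasible (G : SimpleGraph V) (B : Matrix V V ℝ) : Prop where
  /-- `B` is positive semidefinite -/
  posSemidef : B.PosSemidef
  /-- `Tr B = 1` -/
  trace_eq_one : B.trace = 1
  /-- `B_{uv} ≤ 0` on the edges of `G` -/
  apply_nonpos : ∀ ⦃u v : V⦄, G.Adj u v → B u v ≤ 0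

/-- **Szegedy's `ϑ⁺(G) = sup {⟨J, B⟩ : B ⪰ 0, Tr B = 1, B_{uv} ≤ 0 (uv ∈ E)}`**
[cite: SilvaEtAl2019, §4 (ϑ⁺; arXiv p. 6)] [cite: Szegedy1994]. A real supremum over a set
bounded by `|V|`; for empty `V` the junk value `sSup ∅ = 0`. -/
def szegedyTheta (G : SimpleGraph V) : ℝ :=
  sSup (entrySum '' {B | IsThetaPlusFeasible G B})

variable (G : SimpleGraph V)

/-- Every Lovász-feasible matrix is `ϑ⁺`-feasible (`= 0` implies `≤ 0`).
[cite: SilvaEtAl2019, §4 (ϑ ≤ ϑ⁺; arXiv p. 6)] -/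
theorem isThetaPlusFeasible_of_isThetaFeasible {B : Matrix V V ℝ} (hB : IsThetaFeasible G B) :
    IsThetaPlusFeasible G B :=
  ⟨hB.posSemidef, hB.trace_eq_one, fun _ _ huv => (hB.apply_eq_zero huv).le⟩

/-- A `ϑ⁺`-feasible matrix (for any `G`) is Lovász-feasible for the edgeless graph, whose
programme has no edge constraints. [folklore] -/
@[folklore] private theorem IsThetaPlusFeasible.isThetaFeasible_bot {B : Matrix V V ℝ}
    (hB : IsThetaPlusFeasible G B) : IsThetaFeasible (⊥ : SimpleGraph V) B :=
  ⟨hB.posSemidef, hB.trace_eq_one,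
    fun u v huv => False.elim ((SimpleGraph.bot_adj u v).1 huv)⟩

/-- The objective is bounded by the order: `𝟙ᵀB𝟙 ≤ |V| · Tr B = |V|` for `ϑ⁺`-feasible `B`
(only `B ⪰ 0` and `Tr B = 1` are used — the tree's `entrySum_le_card`). [folklore] -/
@[folklore] private theorem entrySum_le_card_of_isThetaPlusFeasible [DecidableEq V]
    {B : Matrix V V ℝ} (hB : IsThetaPlusFeasible G B) : entrySum B ≤ Fintype.card V :=
  entrySum_le_card (hB.isThetaFeasible_bot G)

/-- The `ϑ⁺`-feasible values are bounded above (by `|V|`). [folklore] -/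
@[folklore] private theorem bddAbove_thetaPlusValues :
    BddAbove (entrySum '' {B | IsThetaPlusFeasible G B}) := by
  classical
  refine ⟨Fintype.card V, ?_⟩
  rintro _ ⟨B, hB, rfl⟩
  exact entrySum_le_card_of_isThetaPlusFeasible G hB

/-- The Lovász-feasible values are among the `ϑ⁺`-feasible values. [folklore] -/
@[folklore] private theorem thetaValues_subset_thetaPlusValues :
    entrySum '' {B | IsThetaFeasible G B} ⊆ entrySum '' {B | IsThetaPlusFeasible G B} := by
  rintro _ ⟨B, hB, rfl⟩
  exact ⟨B, isThetaPlusFeasible_of_isThetaFeasible G hB, rfl⟩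

/-- `|V|⁻¹ I` is `ϑ⁺`-feasible on a nonempty vertex set (the programme is feasible).
[cite: SilvaEtAl2019, §4 (ϑ⁺; arXiv p. 6)] -/
theorem isThetaPlusFeasible_smul_one [DecidableEq V] [Nonempty V] :
    IsThetaPlusFeasible G ((Fintype.card V : ℝ)⁻¹ • (1 : Matrix V V ℝ)) :=
  isThetaPlusFeasible_of_isThetaFeasible G (isThetaFeasible_smul_one G)

/-- Every feasible value is at most `ϑ⁺(G)`. [cite: SilvaEtAl2019, §4 (ϑ⁺ as a maximum;
arXiv p. 6)] -/
theorem entrySum_le_szegedyTheta {B : Matrix V V ℝ} (hB : IsThetaPlusFeasible G B) :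
    entrySum B ≤ szegedyTheta G :=
  le_csSup (bddAbove_thetaPlusValues G) ⟨B, hB, rfl⟩

/-- `0 ≤ ϑ⁺(G)`: every feasible value `𝟙ᵀB𝟙` is nonnegative (`B ⪰ 0`), and `sSup ∅ = 0`.
[cite: SilvaEtAl2019, §4 (ϑ⁺; arXiv p. 6)] -/
theorem szegedyTheta_nonneg [DecidableEq V] : 0 ≤ szegedyTheta G := by
  refine Real.sSup_nonneg ?_
  rintro _ ⟨B, hB, rfl⟩
  rw [entrySum_eq]
  have := hB.posSemidef.dotProduct_mulVec_nonneg (indVec univ)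
  rwa [star_trivial] at this

/-! ### `ϑ ≤ ϑ⁺ ≤ |V|`, antitonicity, `α ≤ ϑ⁺` -/

/-- **`ϑ(G) ≤ ϑ⁺(G)`** — the relaxation only enlarges the feasible set.
[cite: SilvaEtAl2019, §4 (ϑ ≤ ϑ⁺; arXiv p. 6)] [cite: CubittEtAl2013, Definition 5 ("Clearly
ϑ̄⁻(G) ≤ ϑ̄(G) ≤ ϑ̄⁺(G)"; arXiv p. 8)] -/
theorem lovaszTheta_le_szegedyTheta [DecidableEq V] : lovaszTheta G ≤ szegedyTheta G := by
  by_cases hne : (entrySum '' {B | IsThetaFeasible G B}).Nonempty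
  · exact csSup_le_csSup (bddAbove_thetaPlusValues G) hne (thetaValues_subset_thetaPlusValues G)
  · rw [Set.not_nonempty_iff_eq_empty] at hne
    rw [lovaszTheta, hne, Real.sSup_empty]
    exact szegedyTheta_nonneg G

/-- **`ϑ⁺(G) ≤ |V|`** (from `entrySum_le_card_of_isThetaPlusFeasible`; in the source via
`ϑ⁺(G) ≤ χ(Ḡ) ≤ |V|`). [cite: SilvaEtAl2019, §4 (ϑ⁺ ≤ χ(Ḡ); arXiv p. 6)] -/
theorem szegedyTheta_le_card [DecidableEq V] : szegedyTheta G ≤ Fintype.card V := by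
  refine Real.sSup_le ?_ (Nat.cast_nonneg _)
  rintro _ ⟨B, hB, rfl⟩
  exact entrySum_le_card_of_isThetaPlusFeasible G hB

/-- Feasibility is inherited by subgraphs: fewer edges, fewer constraints. [folklore] -/
@[folklore] private theorem IsThetaPlusFeasible.anti {H H' : SimpleGraph V} (hHH' : H' ≤ H)
    {B : Matrix V V ℝ} (hB : IsThetaPlusFeasible H B) : IsThetaPlusFeasible H' B :=
  ⟨hB.posSemidef, hB.trace_eq_one, fun _ _ huv => hB.apply_nonpos (hHH' huv)⟩

/-- **`ϑ⁺` is antitone**: `H' ≤ H → ϑ⁺(H) ≤ ϑ⁺(H')` (fewer edges, fewer constraints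
`X ∘ A ≤ 0`). [cite: SilvaEtAl2019, §4 (the programme defining ϑ⁺; arXiv p. 6)] -/
theorem szegedyTheta_anti [DecidableEq V] {H H' : SimpleGraph V} (hHH' : H' ≤ H) :
    szegedyTheta H ≤ szegedyTheta H' := by
  by_cases hne : ({B | IsThetaPlusFeasible H B} : Set (Matrix V V ℝ)).Nonempty
  · exact csSup_le_csSup (bddAbove_thetaPlusValues H') (hne.image _)
      (Set.image_mono fun B hB => IsThetaPlusFeasible.anti hHH' hB)
  · rw [Set.not_nonempty_iff_eq_empty] at hne
    rw [szegedyTheta, hne, Set.image_empty, Real.sSup_empty]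
    exact szegedyTheta_nonneg H'

/-- **`α(G) ≤ ϑ⁺(G)`** (through `α ≤ ϑ`: the tree's clique bound
`le_lovaszTheta_compl_of_isNClique` on a maximum independent set, a clique of `Gᶜ`).
[cite: SilvaEtAl2019, §4 (α ≤ ϑ⁻ ≤ ϑ ≤ ϑ⁺; arXiv p. 6)] -/
theorem indepNum_le_szegedyTheta [DecidableEq V] : (G.indepNum : ℝ) ≤ szegedyTheta G := by
  obtain ⟨S, hS⟩ := G.exists_isNIndepSet_indepNum
  have h := le_lovaszTheta_compl_of_isNClique ((SimpleGraph.isNClique_compl _).2 hS)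
  rw [compl_compl] at h
  exact h.trans (lovaszTheta_le_szegedyTheta G)

/-! ### The colouring bound `ϑ⁺(Ḡ) ≤ χ(G)` -/

/-- Within a colour class of a proper colouring of `G`, a `ϑ⁺`-feasible matrix for `Gᶜ` has
off-diagonal entries `≤ 0` (distinct vertices of one colour are non-adjacent in `G`, i.e.
adjacent in `Gᶜ`), so `𝟙_aᵀ B 𝟙_a ≤ Σ_{u ∈ V_a} B_{uu}`. [folklore] -/
@[folklore] private theorem indVec_colorClass_self_le [DecidableEq V] {G : SimpleGraph V}
    {B : Matrix V V ℝ} (hB : IsThetaPlusFeasible Gᶜ B) {c : ℕ} (C : G.Coloring (Fin c))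
    (a : Fin c) :
    indVec (univ.filter fun u => C u = a) ⬝ᵥ B *ᵥ indVec (univ.filter fun u => C u = a) ≤
      ∑ u ∈ univ.filter (fun u => C u = a), B u u := by
  rw [indVec_dotProduct_mulVec_indVec]
  refine sum_le_sum fun u hu => ?_
  rw [← add_sum_erase _ (fun v => B u v) hu]
  refine add_le_of_nonpos_right (sum_nonpos fun v hv => ?_)
  have hvu : v ≠ u := ne_of_mem_erase hv
  have hcu := (mem_filter.1 hu).2
  have hcv := (mem_filter.1 (mem_of_mem_erase hv)).2
  refine hB.apply_nonpos ((SimpleGraph.compl_adj _ _ _).2 ⟨fun h => hvu h.symm, fun hadj => ?_⟩)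
  exact C.valid hadj (hcu.trans hcv.symm)

/-- **Colouring half of Szegedy's sandwich** (`ϑ⁺(G) ≤ χ(Ḡ)`, here for the complement:
`ϑ⁺(Gᶜ) ≤ c` for every proper `c`-colouring of `G`). Proof: for feasible `B` and colour classes
`V_1, …, V_c`, `𝟙ᵀB𝟙 = Σ_{a,b} 𝟙_aᵀB𝟙_b ≤ Σ_{a,b} (𝟙_aᵀB𝟙_a + 𝟙_bᵀB𝟙_b)/2 = c Σ_a 𝟙_aᵀB𝟙_a
≤ c · Tr B = c`, the last step by `indVec_colorClass_self_le`.
[cite: SilvaEtAl2019, §4 (ϑ⁺(G) ≤ χ(Ḡ); arXiv p. 6)] [cite: CubittEtAl2013, §3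
(α(G) ≤ ϑ⁻(G) ≤ ϑ(G) ≤ ϑ⁺(G) ≤ χ(Ḡ); arXiv p. 9)] -/
theorem szegedyTheta_compl_le_of_coloring [DecidableEq V] {G : SimpleGraph V} {c : ℕ}
    (C : G.Coloring (Fin c)) : szegedyTheta Gᶜ ≤ c := by
  refine Real.sSup_le ?_ (Nat.cast_nonneg c)
  rintro _ ⟨B, hB, rfl⟩
  -- colour classes and their indicator forms
  set cls : Fin c → Finset V := fun a => univ.filter fun u => C u = a with hcls
  set F : Fin c → Fin c → ℝ := fun a b => indVec (cls a) ⬝ᵥ B *ᵥ indVec (cls b) with hF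
  -- split the objective along the classes
  have hsplit : entrySum B = ∑ a, ∑ b, F a b := by
    have h1 : ∀ f : V → ℝ, ∑ u, f u = ∑ a, ∑ u ∈ cls a, f u := fun f =>
      (sum_fiberwise (univ : Finset V) C f).symm
    calc entrySum B = ∑ u, ∑ v, B u v := rfl
      _ = ∑ a, ∑ u ∈ cls a, ∑ b, ∑ v ∈ cls b, B u v := by
          rw [h1]
          refine sum_congr rfl fun a _ => sum_congr rfl fun u _ => h1 _
      _ = ∑ a, ∑ b, ∑ u ∈ cls a, ∑ v ∈ cls b, B u v := by
          refine sum_congr rfl fun a _ => ?_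
          rw [sum_comm]
      _ = ∑ a, ∑ b, F a b :=
          sum_congr rfl fun a _ => sum_congr rfl fun b _ =>
            (indVec_dotProduct_mulVec_indVec B (cls a) (cls b)).symm
  -- diagonal forms sum to at most the trace
  have hdiag : ∑ a, F a a ≤ 1 := by
    have h1 : ∀ a, F a a ≤ ∑ u ∈ cls a, B u u := fun a => indVec_colorClass_self_le hB C a
    have h2 : ∑ a, ∑ u ∈ cls a, B u u = 1 := by
      rw [sum_fiberwise (univ : Finset V) C fun u => B u u]
      have := hB.trace_eq_one
      rwa [Matrix.trace] at this
    calc ∑ a, F a a ≤ ∑ a, ∑ u ∈ cls a, B u u := sum_le_sum fun a _ => h1 a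
      _ = 1 := h2
  -- the arithmetic–geometric step
  have hab : ∀ a b, F a b ≤ (F a a + F b b) / 2 := fun a b => by
    have := two_mul_dotProduct_mulVec_le hB.posSemidef (indVec (cls a)) (indVec (cls b))
    simp only [hF] at this ⊢
    linarith
  have hsum : ∑ a, ∑ b, (F a a + F b b) / 2 = (c : ℝ) * ∑ a, F a a := by
    simp only [add_div, sum_add_distrib, sum_const, card_univ, Fintype.card_fin, nsmul_eq_mul]
    rw [mul_sum, mul_sum, ← sum_add_distrib]
    exact sum_congr rfl fun a _ => by ring
  calc entrySum B = ∑ a, ∑ b, F a b := hsplit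
    _ ≤ ∑ a, ∑ b, (F a a + F b b) / 2 := sum_le_sum fun a _ => sum_le_sum fun b _ => hab a b
    _ = (c : ℝ) * ∑ a, F a a := hsum
    _ ≤ (c : ℝ) * 1 := mul_le_mul_of_nonneg_left hdiag (Nat.cast_nonneg c)
    _ = c := mul_one _

/-- **`ϑ⁺(G) ≤ k` whenever `Ḡ` is `k`-colourable** (a cover of `V` by `k` cliques of `G`).
[cite: SilvaEtAl2019, §4 (ϑ⁺(G) ≤ χ(Ḡ); arXiv p. 6)] -/
theorem szegedyTheta_le_of_compl_colorable [DecidableEq V] {k : ℕ} (hc : Gᶜ.Colorable k) :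
    szegedyTheta G ≤ k := by
  obtain ⟨C⟩ := hc
  have h := szegedyTheta_compl_le_of_coloring C
  rwa [compl_compl] at h

/-- **Szegedy's sandwich** `α(G) ≤ ϑ(G) ≤ ϑ⁺(G) ≤ χ(Ḡ)`: for `Ḡ` `k`-colourable,
`α(G) ≤ ϑ(G)`, `ϑ(G) ≤ ϑ⁺(G)` and `ϑ⁺(G) ≤ k`. [cite: SilvaEtAl2019, §4 (the chain
α ≤ ϑ⁻ ≤ ϑ ≤ ϑ⁺ ≤ χ(Ḡ); arXiv p. 6)] [cite: CubittEtAl2013, §3 (arXiv p. 9)]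
[cite: Szegedy1994] -/
theorem sandwich_plus [DecidableEq V] {k : ℕ} (hc : Gᶜ.Colorable k) :
    (G.indepNum : ℝ) ≤ lovaszTheta G ∧ lovaszTheta G ≤ szegedyTheta G ∧
      szegedyTheta G ≤ k := by
  refine ⟨?_, lovaszTheta_le_szegedyTheta G, szegedyTheta_le_of_compl_colorable G hc⟩
  obtain ⟨S, hS⟩ := G.exists_isNIndepSet_indepNum
  have h := le_lovaszTheta_compl_of_isNClique ((SimpleGraph.isNClique_compl _).2 hS)
  rwa [compl_compl] at h

/-! ### Sanity values -/

/-- **`ϑ⁺(K_n) = 1`** (`n ≥ 1`): `≥` from `ϑ(K_n) ≥ 1` (`one_le_lovaszTheta`), `≤` from the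
colouring bound with the one-colouring of `K̄_n = ⊥`. [cite: SilvaEtAl2019, §4 (the chain
1 = α(K_n) ≤ ϑ⁺(K_n) ≤ χ(K̄_n) = 1; arXiv p. 6)] -/
theorem szegedyTheta_top [DecidableEq V] [Nonempty V] : szegedyTheta (⊤ : SimpleGraph V) = 1 := by
  refine le_antisymm ?_ ((one_le_lovaszTheta _).trans (lovaszTheta_le_szegedyTheta _))
  have C : (⊥ : SimpleGraph V).Coloring (Fin 1) :=
    SimpleGraph.Coloring.mk (fun _ => 0) fun {u v} h => False.elim ((SimpleGraph.bot_adj u v).1 h)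
  have h := szegedyTheta_compl_le_of_coloring C
  rw [compl_bot, Nat.cast_one] at h
  exact h

/-- **`ϑ⁺(K̄_n) = n`** (`n ≥ 1`): `≤` is `ϑ⁺ ≤ |V|`, `≥` is `n = ω(K_n) ≤ ϑ(K̄_n) ≤ ϑ⁺(K̄_n)`.
[cite: SilvaEtAl2019, §4 (the chain n = α(K̄_n) ≤ ϑ⁺(K̄_n) ≤ χ(K_n) = n; arXiv p. 6)] -/
theorem szegedyTheta_bot [DecidableEq V] [Nonempty V] :
    szegedyTheta (⊥ : SimpleGraph V) = Fintype.card V := by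
  refine le_antisymm (szegedyTheta_le_card _) ?_
  have hS : (⊤ : SimpleGraph V).IsNClique (Fintype.card V) univ :=
    ⟨fun u _ v _ huv => (SimpleGraph.top_adj u v).2 huv, card_univ⟩
  have h := le_lovaszTheta_compl_of_isNClique hS
  rw [compl_top] at h
  exact h.trans (lovaszTheta_le_szegedyTheta _)

end Literature.Combinatorics.SimpleGraph.SzegedyTheta
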